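import Mathlib.Algebra.Polynomial.Taylor
import Mathlib.Algebra.Polynomial.HasseDeriv
import Mathlib.Analysis.Complex.ExponentialBounds
import Literature.Analysis.Approximation.MarkovInequality
import HarnessLib

/-!
# Stengle's lower complexity bound: a representation `1 − x² + δ = P (1 − x²)³ + Q` with
# `P, Q ≥ 0` forces `deg P ≥ c · δ^{−1/2}`

SOS / certified-positivity series (companion of `StengleExample.lean`: there, `1 − x² ∉
T((1 − x²)³)` while `1 − x² + δ ∈ T((1 − x²)³)` for every `δ > 0`; here, the DEGREE of any such
representation must blow up like `δ^{−1/2}`).  Theorems only, no named fact.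

## Source, quoted

G. Stengle, *Complexity Estimates for the Schmüdgen Positivstellensatz*, J. Complexity **12**
(1996) 167–174 [bib `Stengle1996`; held text `paper:doi-10-1006-jcom-1996-0011`], §2 «A lower
complexity bound» (pp. 169–171, chunks p0003–p0005):

«**THEOREM 4.** Let `N(δ)` be the least degree of any `P` for which the relations
`1 − x² + δ = P(1 − x²)³ + Q`, `P, Q ≥ 0` hold. Then there is a constant `C` such that
`N(δ) ≥ Cδ^{−1/2}`.
*Proof.* We use some tools of analysis, particularly approximation theory. A classical extremal
property of the Chebyshev polynomials `T_n(x)` [2] ensures that if degree `(P) = n` then for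
`a ≥ 1`, `max_{|x| ≤ a} |P(x)| ≤ |T_n(a)| max_{|x| ≤ 1} |P(x)|. (2) We require a consequence of
this which relates bounds on intervals larger and smaller than `[−1, 1]`. For `0 < r < 1` we have
`max_{x² ≤ 1/(1−r)} |P(x)| … ≤ T_n(1/(1 − r)) max_{x² ≤ 1−r} |P(x)|. (3) Next (1) and the
positivity of `Q` imply that `max_{x² ≤ 1−r} P(x) ≤ δr^{−3} + r^{−2}. (4) Let `u = x² − 1`. Then for
`1 ≤ x² ≤ 1/(1 − r)` or equivalently for `0 ≤ u ≤ r/(1 − r)` (5) (3) and (4) imply that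
`δ ≥ u − u³(δr^{−3} + r^{−2})T_n(1/(1 − r)). (6) … The choice `r = n^{−2}` and `u = r/2` gives …
which for large `n` implies `n²δ ≥ c > 0`, completing the proof.»

## What is formalised, and the one deviation

`stengle_theorem4`: if `1 − X² + C δ = P · (1 − X²)³ + Q` in `ℝ[X]` with `P(x) ≥ 0`, `Q(x) ≥ 0`
for all real `x` and `deg P ≤ n`, `n ≥ 1`, then `δ ≥ 1/(11 n²)` — i.e. **`N(δ) ≥ (11 δ)^{−1/2}`**
(`stengle_degree_lower_bound`), an explicit instance of the printed `Cδ^{−1/2}`; with `δ = 0` it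
re-proves the non-existence of any representation (`no_representation_at_zero`).

The proof is Stengle's (4)–(5)–(6) verbatim with ONE substitution, recorded here: the growth factor
from the inner interval `{x² ≤ 1 − r}` to the outer point is not taken from the Chebyshev extremal
property (2)–(3) (not in the tree) but from the tree's **Markov inequality**
(`Literature.Analysis.Approximation.markov_inequality_Icc`, Korneichuk Thm 3.5.8) iterated `k`
times (`|P^{(k)}| ≤ (n²/b)^k · max_{[−b,b]} |P|`) and the exact Taylor expansion of `P` at `b`
(`Polynomial.taylor`, `hasseDeriv`): `|P(b + s)| ≤ max_{[−b,b]}|P| · Σ_{k ≤ n} (n²s/b)^k/k! ≤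
e · max_{[−b,b]}|P| ≤ 3 · max_{[−b,b]}|P|` whenever `n² s ≤ b` (`abs_eval_add_le_three_mul`) —
like `T_n(1/(1 − r))` with `r ~ n^{−2}`, a growth factor bounded independently of `n` at distance
`~ n^{−2}` from the interval, which is all the printed argument uses.  Constants: `r = 1/(2n²)`,
inner interval `[−b, b]`, `b = √(1 − r)` (so (4): `0 ≤ P ≤ (r + δ)/r³` there), outer point
`x₊ = √(1 + r/4)` (i.e. `u = r/4` in (5)), `s = x₊ − b ≤ 9r/8`, `n² s ≤ 9/16 ≤ b`; then (6) reads
`δ ≥ r/4 − 3 · (r + δ)/r³ · (r/4)³ = r/4 − 3(r + δ)/64`, i.e. `δ ≥ 13r/67 ≥ 1/(11n²)`.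

Not formalised: Theorem 3 (general compactness argument), Theorem 5 (the upper bound
`C(Mm²/δ)^{1/2} log(Mm²/δ)`), the Chebyshev extremal property itself.
-/

noncomputable section

open Polynomial Finset Real Set
open scoped Nat

namespace Literature.Algebra.Polynomial.StengleDegreeLowerBound

open Literature.Analysis.Approximation (markov_inequality_Icc)

/-! ## §1 Growth of a polynomial slightly outside an interval, from Markov's inequality -/

/-- Iterated derivatives do not increase the degree bound. [folklore] -/
private theorem natDegree_iterate_derivative_le' {P : ℝ[X]} {n : ℕ} (h : P.natDegree ≤ n)
    (k : ℕ) : (derivative^[k] P).natDegree ≤ n :=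
  (natDegree_iterate_derivative P k).trans ((Nat.sub_le _ _).trans h)

/-- **Iterated Markov inequality.** If `deg P ≤ n` and `|P| ≤ M` on `[−b, b]` (`b > 0`), then
`|P^{(k)}| ≤ (n²/b)^k · M` on `[−b, b]` for every `k` (Markov's inequality `‖p'‖ ≤ 2n²‖p‖/(b−a)`
applied `k` times, each time with the degree bound `n`).
[cite: Korneichuk1991, Thm 3.5.8 (§3.5.4), via the tree's `markov_inequality_Icc`]
[cite: Stengle1996, §2 proof of Thm 4, growth step (2)–(3) (p. 170)] -/
theorem abs_iterate_derivative_le {P : ℝ[X]} {n : ℕ} (hdeg : P.natDegree ≤ n) {b M : ℝ}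
    (hb : 0 < b) (hM : ∀ y ∈ Icc (-b) b, |P.eval y| ≤ M) (k : ℕ) :
    ∀ y ∈ Icc (-b) b, |(derivative^[k] P).eval y| ≤ ((n : ℝ) ^ 2 / b) ^ k * M := by
  induction k with
  | zero => simpa using hM
  | succ k ih =>
    intro y hy
    rw [Function.iterate_succ_apply']
    have hdk : (derivative^[k] P).degree ≤ n :=
      (degree_le_of_natDegree_le (natDegree_iterate_derivative_le' hdeg k))
    have h := markov_inequality_Icc hdk (by linarith : -b < b) ih hy
    calc |(derivative (derivative^[k] P)).eval y|
        ≤ 2 * (n : ℝ) ^ 2 * (((n : ℝ) ^ 2 / b) ^ k * M) / (b - -b) := h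
      _ = ((n : ℝ) ^ 2 / b) ^ (k + 1) * M := by
          have hb' : b ≠ 0 := hb.ne'
          have h2b : b - -b = 2 * b := by ring
          rw [h2b]
          simp only [div_pow]
          field_simp
          ring

/-- Exact Taylor expansion at `b` of a polynomial of degree `≤ n`:
`P(b + s) = Σ_{k ≤ n} (D_k P)(b) s^k` with `D_k` the Hasse derivative `P^{(k)}/k!`.
[cite: Stengle1996, §2 proof of Thm 4 (growth step)] -/
theorem eval_add_eq_sum_hasseDeriv {P : ℝ[X]} {n : ℕ} (hdeg : P.natDegree ≤ n) (b s : ℝ) :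
    P.eval (b + s) = ∑ k ∈ range (n + 1), (hasseDeriv k P).eval b * s ^ k := by
  have h1 : P.eval (b + s) = (taylor b P).eval s := by
    rw [taylor_eval, add_comm]
  have hlt : (taylor b P).natDegree < n + 1 :=
    lt_of_le_of_lt ((natDegree_taylor P b).le.trans hdeg) (Nat.lt_succ_self n)
  rw [h1, eval_eq_sum_range' hlt]
  simp only [taylor_coeff]

/-- `k! · (D_k P)(b) = P^{(k)}(b)` (Hasse derivative versus iterated derivative). [folklore] -/
private theorem factorial_mul_eval_hasseDeriv (P : ℝ[X]) (k : ℕ) (b : ℝ) :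
    (k ! : ℝ) * (hasseDeriv k P).eval b = (derivative^[k] P).eval b := by
  have h := congrFun (factorial_smul_hasseDeriv (R := ℝ) (k := k)) P
  simp only [LinearMap.smul_apply] at h
  rw [← h, eval_smul, nsmul_eq_mul]

/-- **Growth outside the interval (the substitute for the Chebyshev extremal property).** If
`deg P ≤ n`, `|P| ≤ M` on `[−b, b]` (`b > 0`) and `0 ≤ s` with `n² s ≤ b`, then
`|P(b + s)| ≤ 3M`: by Taylor and iterated Markov, `|P(b+s)| ≤ M Σ_{k≤n} (n²s/b)^k/k! ≤ M e^{n²s/b}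
≤ e M`. [cite: Stengle1996, §2 proof of Thm 4, (2)–(3) (p. 170) — replaced as documented]
[cite: Korneichuk1991, Thm 3.5.8] -/
theorem abs_eval_add_le_three_mul {P : ℝ[X]} {n : ℕ} (hdeg : P.natDegree ≤ n) {b M : ℝ}
    (hb : 0 < b) (hM : ∀ y ∈ Icc (-b) b, |P.eval y| ≤ M) {s : ℝ} (hs0 : 0 ≤ s)
    (hs : (n : ℝ) ^ 2 * s ≤ b) : |P.eval (b + s)| ≤ 3 * M := by
  have hbI : b ∈ Icc (-b) b := ⟨by linarith, le_rfl⟩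
  have hM0 : 0 ≤ M := (abs_nonneg _).trans (hM b hbI)
  set t : ℝ := (n : ℝ) ^ 2 * s / b with ht
  have ht0 : 0 ≤ t := by positivity
  have ht1 : t ≤ 1 := by rwa [ht, div_le_one hb]
  have hterm : ∀ k ∈ range (n + 1),
      |(hasseDeriv k P).eval b * s ^ k| ≤ M * (t ^ k / k !) := by
    intro k _
    have hkpos : (0 : ℝ) < k ! := by positivity
    have hder := abs_iterate_derivative_le hdeg hb hM k b hbI
    rw [← factorial_mul_eval_hasseDeriv, abs_mul, Nat.abs_cast] at hder
    -- `|D_k P (b)| ≤ (n²/b)^k M / k!`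
    have hk : |(hasseDeriv k P).eval b| ≤ ((n : ℝ) ^ 2 / b) ^ k * M / k ! := by
      rw [le_div_iff₀ hkpos]
      linarith [hder]
    rw [abs_mul, abs_pow, abs_of_nonneg hs0]
    calc |(hasseDeriv k P).eval b| * s ^ k ≤ ((n : ℝ) ^ 2 / b) ^ k * M / k ! * s ^ k := by
          gcongr
      _ = M * (t ^ k / k !) := by
          have hb' : b ≠ 0 := hb.ne'
          rw [ht]
          simp only [div_pow, mul_pow]
          field_simp
  rw [eval_add_eq_sum_hasseDeriv hdeg]
  calc |∑ k ∈ range (n + 1), (hasseDeriv k P).eval b * s ^ k|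
      ≤ ∑ k ∈ range (n + 1), |(hasseDeriv k P).eval b * s ^ k| := abs_sum_le_sum_abs _ _
    _ ≤ ∑ k ∈ range (n + 1), M * (t ^ k / k !) := sum_le_sum hterm
    _ = M * ∑ k ∈ range (n + 1), t ^ k / k ! := by rw [mul_sum]
    _ ≤ M * 3 := by
        gcongr
        calc ∑ k ∈ range (n + 1), t ^ k / k ! ≤ exp t := Real.sum_le_exp_of_nonneg ht0 _
          _ ≤ exp 1 := exp_le_exp.mpr ht1
          _ ≤ 3 := le_of_lt exp_one_lt_three
    _ = 3 * M := by ring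

/-! ## §2 Theorem 4 -/

/-- **THEOREM 4 (Stengle 1996), explicit form.**  If `1 − x² + δ = P(1 − x²)³ + Q` with
polynomials `P, Q` that are nonnegative on `ℝ` and `deg P ≤ n` (`n ≥ 1`), then `δ ≥ 1/(11 n²)`.
Proof = the printed (4)–(6) with `r = 1/(2n²)`, `u = r/4`, and the growth factor `3` of
`abs_eval_add_le_three_mul` in place of `T_n(1/(1−r))` (module docstring).
[cite: Stengle1996, Thm 4 with proof, (4)–(6) (pp. 170–171)] -/
theorem stengle_theorem4 {δ : ℝ} {P Q : ℝ[X]} (hP : ∀ x : ℝ, 0 ≤ P.eval x)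
    (hQ : ∀ x : ℝ, 0 ≤ Q.eval x) (h : (1 - X ^ 2 + C δ : ℝ[X]) = P * (1 - X ^ 2) ^ 3 + Q)
    {n : ℕ} (hn : 1 ≤ n) (hdeg : P.natDegree ≤ n) : 1 / (11 * (n : ℝ) ^ 2) ≤ δ := by
  -- the identity, pointwise
  have hid : ∀ x : ℝ, 1 - x ^ 2 + δ = P.eval x * (1 - x ^ 2) ^ 3 + Q.eval x := by
    intro x
    have hx := congrArg (eval x) h
    simpa using hx
  -- `δ = Q(1) ≥ 0`
  have hδ : 0 ≤ δ := by
    have h1 := hid 1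
    nlinarith [hQ 1]
  -- the parameters `N = n²`, `r = 1/(2N)`, `b = √(1 − r)`
  set N : ℝ := (n : ℝ) ^ 2 with hN
  have hN1 : 1 ≤ N := by
    have h1 : (1 : ℝ) ≤ n := by exact_mod_cast hn
    rw [hN]
    nlinarith
  set r : ℝ := 1 / (2 * N) with hr
  have hr0 : 0 < r := by positivity
  have hrN : r * N = 1 / 2 := by rw [hr]; field_simp
  have hr1 : r ≤ 1 / 2 := by
    rw [hr]
    exact one_div_le_one_div_of_le (by norm_num) (by linarith)
  set b : ℝ := Real.sqrt (1 - r) with hb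
  have hb2 : b ^ 2 = 1 - r := by rw [hb]; exact Real.sq_sqrt (by linarith)
  have hb0 : 0 < b := by rw [hb]; exact Real.sqrt_pos.mpr (by linarith)
  have hb916 : 9 / 16 ≤ b := by
    rw [hb]
    exact Real.le_sqrt_of_sq_le (by linarith)
  have hb1r : 1 - r ≤ b := by
    rw [hb]
    exact Real.le_sqrt_of_sq_le (by nlinarith)
  -- (4): `0 ≤ P ≤ M := (r + δ)/r³` on `x² ≤ 1 − r`, i.e. on `[−b, b]`
  set M : ℝ := (r + δ) / r ^ 3 with hM
  have hinner : ∀ y ∈ Icc (-b) b, |P.eval y| ≤ M := by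
    intro y hy
    have hyb : y ^ 2 ≤ b ^ 2 := by
      have hab : |y| ≤ |b| := by
        rw [abs_of_pos hb0]
        exact abs_le.mpr ⟨hy.1, hy.2⟩
      simpa only [sq_abs] using pow_le_pow_left₀ (abs_nonneg y) hab 2
    set u : ℝ := 1 - y ^ 2 with hu
    have hur : r ≤ u := by rw [hu]; linarith [hb2]
    have hu0 : 0 < u := lt_of_lt_of_le hr0 hur
    have hPu : P.eval y * u ^ 3 ≤ u + δ := by
      have h1 := hid y
      rw [← hu] at h1
      linarith [hQ y]
    rw [abs_of_nonneg (hP y), hM, le_div_iff₀ (by positivity)]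
    have h2 : u * r ^ 3 ≤ r * u ^ 3 := by
      have hsq : r ^ 2 ≤ u ^ 2 := pow_le_pow_left₀ hr0.le hur 2
      nlinarith [mul_le_mul_of_nonneg_left hsq (mul_nonneg hu0.le hr0.le)]
    have h3 : δ * r ^ 3 ≤ δ * u ^ 3 :=
      mul_le_mul_of_nonneg_left (pow_le_pow_left₀ hr0.le hur 3) hδ
    have h4 : P.eval y * r ^ 3 * u ^ 3 ≤ (r + δ) * u ^ 3 := by
      calc P.eval y * r ^ 3 * u ^ 3 = (P.eval y * u ^ 3) * r ^ 3 := by ring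
        _ ≤ (u + δ) * r ^ 3 := mul_le_mul_of_nonneg_right hPu (by positivity)
        _ = u * r ^ 3 + δ * r ^ 3 := by ring
        _ ≤ r * u ^ 3 + δ * u ^ 3 := add_le_add h2 h3
        _ = (r + δ) * u ^ 3 := by ring
    exact le_of_mul_le_mul_right h4 (by positivity)
  -- the outer point `x₊ = √(1 + r/4)`: `x₊² = 1 + u`, `u = r/4` (printed (5) with `u = r/4`)
  set xp : ℝ := Real.sqrt (1 + r / 4) with hxp
  have hxp2 : xp ^ 2 = 1 + r / 4 := by rw [hxp]; exact Real.sq_sqrt (by positivity)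
  have hbxp : b ≤ xp := by rw [hb, hxp]; exact Real.sqrt_le_sqrt (by linarith)
  have hxp1 : xp ≤ 1 + r / 8 := by
    rw [hxp, Real.sqrt_le_left (by positivity)]
    nlinarith
  -- `s = x₊ − b`, `0 ≤ s ≤ 9r/8`, so `n² s ≤ 9/16 ≤ b`
  set s : ℝ := xp - b with hs
  have hs0 : 0 ≤ s := by rw [hs]; linarith
  have hs98 : s ≤ 9 * r / 8 := by rw [hs]; linarith
  have hNs : N * s ≤ b := by
    have h1 : N * s ≤ N * (9 * r / 8) := mul_le_mul_of_nonneg_left hs98 (by positivity)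
    have h2 : N * (9 * r / 8) = 9 / 16 := by linear_combination (9 / 8 : ℝ) * hrN
    linarith
  -- growth: `|P(x₊)| ≤ 3M` ((2)–(3) replaced by Markov + Taylor)
  have hgrow : |P.eval xp| ≤ 3 * M := by
    have h1 := abs_eval_add_le_three_mul hdeg hb0 hinner hs0 (by rw [← hN]; exact hNs)
    have h2 : b + s = xp := by rw [hs]; ring
    rwa [h2] at h1
  have hPle : P.eval xp ≤ 3 * M := (le_abs_self _).trans hgrow
  -- (6): `δ ≥ u − u³ · 3M` at `u = r/4`
  have hout : δ = r / 4 - P.eval xp * (r / 4) ^ 3 + Q.eval xp := by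
    have h1 := hid xp
    rw [hxp2] at h1
    linear_combination h1
  have h34 : P.eval xp * (r / 4) ^ 3 ≤ 3 * M * (r / 4) ^ 3 :=
    mul_le_mul_of_nonneg_right hPle (by positivity)
  have hMr : M * r ^ 3 = r + δ := by
    rw [hM]
    field_simp
  have h35 : 3 * M * (r / 4) ^ 3 = 3 * (r + δ) / 64 := by
    rw [← hMr]
    ring
  have key : 3 * (r + δ) / 64 + δ ≥ r / 4 := by linarith [hQ xp, hout, h34, h35]
  -- `67 δ ≥ 13 r = 13/(2N)`, hence `δ ≥ 1/(11 N)`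
  rw [div_le_iff₀ (by positivity)]
  nlinarith [key, hrN, hN1]

/-- **`N(δ) ≥ C δ^{−1/2}`** in the printed shape: for any representation as in Theorem 4 with
`deg P ≤ n`, `n ≥ 1`, one has `(11 δ)^{−1/2} ≤ n`, i.e. `1 ≤ 11 δ n²`.
[cite: Stengle1996, Thm 4 (p. 170)] -/
theorem stengle_degree_lower_bound {δ : ℝ} {P Q : ℝ[X]} (hP : ∀ x : ℝ, 0 ≤ P.eval x)
    (hQ : ∀ x : ℝ, 0 ≤ Q.eval x) (h : (1 - X ^ 2 + C δ : ℝ[X]) = P * (1 - X ^ 2) ^ 3 + Q)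
    {n : ℕ} (hn : 1 ≤ n) (hdeg : P.natDegree ≤ n) : Real.sqrt (1 / (11 * δ)) ≤ n := by
  have hmain := stengle_theorem4 hP hQ h hn hdeg
  have hn0 : (0 : ℝ) < n := by exact_mod_cast hn
  have hδ : 0 < δ := lt_of_lt_of_le (by positivity) hmain
  rw [Real.sqrt_le_left hn0.le, div_le_iff₀ (by positivity)]
  rw [div_le_iff₀ (by positivity)] at hmain
  linarith

/-- **The degree must exceed every bound as `δ → 0`; at `δ = 0` there is no representation at
all** (the Example of p. 168 again, now as the `δ = 0` instance of Theorem 4: `1/(11n²) ≤ 0` is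
absurd for every `n ≥ deg P`). [cite: Stengle1996, Example p. 168 and Thm 3/Thm 4 (pp. 169–170)] -/
theorem no_representation_at_zero {P Q : ℝ[X]} (hP : ∀ x : ℝ, 0 ≤ P.eval x)
    (hQ : ∀ x : ℝ, 0 ≤ Q.eval x) : (1 - X ^ 2 : ℝ[X]) ≠ P * (1 - X ^ 2) ^ 3 + Q := by
  intro h
  have h' : (1 - X ^ 2 + C 0 : ℝ[X]) = P * (1 - X ^ 2) ^ 3 + Q := by
    rw [map_zero, add_zero]
    exact h
  have hmain := stengle_theorem4 hP hQ h' (Nat.succ_le_succ (Nat.zero_le P.natDegree))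
    (Nat.le_succ P.natDegree)
  have hpos : (0 : ℝ) < 1 / (11 * ((P.natDegree + 1 : ℕ) : ℝ) ^ 2) := by positivity
  linarith

end Literature.Algebra.Polynomial.StengleDegreeLowerBound
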